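import Literature.NumberTheory.Automorphic.UnitarySimilitudeFixedPointSumTransport   -- ★ B-p10 (g26) (H4) FILE 1: the same-form case, `coe_conj_mul_eq_mul_diagonal`, `even_log_inv_mul_iff_not_even`, `coe_glDiagonal_one_eq`
import Literature.NumberTheory.Automorphic.RamifiedPlaceAntiFixedUniformizer        -- ★ F0P3a-p04 p843426: skew uniformizer `ϖ_E` at a ramified place
import HarnessLib

/-!
# Transport of fixed-point sums between the unitary groups of TWO forms: `D` with `ᵗ(σD) H D = a·H′` gives `Ad(D) : U(H′) ≃ₜ* U(H)`, `K_S ↔ K_{DSD⁻¹}`, `Σ_{Fix}` ↔ `Σ_{Fix}`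
# (the ramified vertex piece: `D_ϖ = diag(1, ϖ_E)`, `ᵗ(σD_ϖ) Φ₂ D_ϖ = ϖ_E·J♯` with `J♯ = [[0,1],[−1,0]]` SKEW-hermitian — Kottwitz 1988 §2; Rogawski 1990 §12.6; Labesse–Langlands 1979 §2)

Topic `NumberTheory/Automorphic`; namespace `Literature.NumberTheory.Automorphic`.  THEOREMS ONLY (no definition, no instance, no notation, no named fact, no `sorry`).  Cell
`pub/hodgecm-mathlib` (D-0151), crux H413 = `stmt-HodgeConjecture-24833`, road «R1-ram» (architect A-p16 (g27)); FILE 1′ = the TWO-FORM generalisation of ★ (H4) FILE 1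
`UnitarySimilitudeFixedPointSumTransport` (p843476), cut for A-p13 (g32)'s (R5b-α) FILE α3 question 10:31:51Z.  HONEST LABEL: HC_CM is proved only modulo the printed citations (the 2
remaining named inputs hLiu418, h413) until rung 0 closes; nothing printed is asserted here — this is group theory.

WHY A SECOND FILE.  ★ FILE 1 transports along a SIMILITUDE of ONE form (`ᵗ(σD)HD = a·H`); at an INERT place `D_ϖ = diag(1, ϖ)` (`σϖ = ϖ`) is such a similitude of `Φ₂` and the `ϖ`-modular
vertex stabiliser `K¹` is `Ad(D_ϖ)(K⁰)` inside `U(Φ₂)`.  At a RAMIFIED place (`σϖ_E = −ϖ_E`) it is NOT: `ᵗ(σD_ϖ) Φ₂ D_ϖ = ϖ_E·J♯` with `J♯ = [[0,1],[−1,0]]` skew-hermitian (§4), the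
similitudes of `Φ₂` (`diag(1,a)`, `a ∈ L⁺_v`) preserve the facet type, and the vertex stabiliser `K♯ = U(Φ₂) ∩ D_ϖ GL₂(𝒪_w) D_ϖ⁻¹` is NOT `U(Φ₂)`-conjugate to the edge stabiliser `K`
(architect RULING A-18).  What survives is the transport between TWO groups: `Ad(D) : U(σ, H′) ≃ₜ* U(σ, H)` whenever `ᵗ(σD) H D = a·H′` with `a ∈ Rˣ` (★ `conj_mem_unitaryGroupOfForm_iff` +
★ `unitaryGroupOfForm_smul_of_isUnit`; §1), carrying `S ∩ U(H′) ↔ DSD⁻¹ ∩ U(H)` (§2), the fixed-point finsums (★ A-p16 p843403 `finsum_mem_fixedBy_quotient_congr_eq`; §3), eigenframes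
(★ FILE 1 `coe_conj_mul_eq_mul_diagonal`) and the frame Gram: **`twistGram σ H′ (D⁻¹P) = a⁻¹ • twistGram σ H P`** (§3).  So the ramified VERTEX piece of (R5b-α) is the EDGE-type depth
expansion on `U(σ_w, J♯)` at level `GL₂(𝒪_w)` (value law = ★ B-p12 `…RamifiedModular`, normal form w.r.t. `J♯`) read back on `U(σ_w, Φ₂)` through §4's `e_ϖ`.

* §1 **`exists_continuousMulEquiv_coe_eq_conj₂`** (`e = Ad(D) : U(H′) ≃ₜ* U(H)`, coe laws).
* §2 `mem_subgroupOf_map_conj_iff₂` (`g ∈ DSD⁻¹ ∩ U(H) ↔ e.symm g ∈ S ∩ U(H′)`), `conj_invariant_comp₂`, `mul_invariant_comp₂`, `comp_eq_zero_of₂`.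
* §3 **`finsum_fixedBy_quotient_mapConj_eq₂`**, `ncard_fixedBy_quotient_mapConj_eq₂`, `finite_fixedBy_quotient_mapConj_iff₂`, **`twistGram_formCongr_coe_inv_mul`**, **`twistGram_coe_inv_mul_eq_inv_smul₂`**.
* §4 CM, ramified `w`: `formCongr_glDiagonal_skew_eq_smul_skewForm` (`ᵗ(σD_ϖ)(Φ₂)_w D_ϖ = ϖ_E • J♯`), **`exists_continuousMulEquiv_sharp_of_skew`** (`e_ϖ : U(σ_w, J♯) ≃ₜ* U(σ_w, (Φ₂)_w)` with the
  level correspondence for every `S ≤ GL₂(L_w)`, on the literal carriers).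

## References
* [Kottwitz1988] R. E. Kottwitz, *Tamagawa numbers*, Ann. of Math. 127 (1988): §2.
* [Rogawski1990] J. D. Rogawski, *Automorphic Representations of Unitary Groups in Three Variables* (1990): §12.6 p. 174; §4.9 Lemma 4.9.3 p. 56.
* [LabesseLanglands1979] J.-P. Labesse, R. P. Langlands, *L-indistinguishability for SL(2)*, Canad. J. Math. 31 (1979): §2 (ramified torus).
* [Kottwitz1986] R. E. Kottwitz, *Base change for unit elements of Hecke algebras*, Compositio Math. 60 (1986): §3.
-/

set_option autoImplicit false

noncomputable section

open MulAction NumberField IsDedekindDomain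
open scoped Matrix MatrixGroups

namespace Literature.NumberTheory.Automorphic

open Literature.NumberTheory.Rogawski1990 (twistGram twistGram_def twistGram_mul)

/-! ## §1 `Ad(D) : U(σ, H′) ≃ₜ* U(σ, H)` for `ᵗ(σD) H D = a·H′` -/

section Generic

variable {R : Type*} [CommRing R] [TopologicalSpace R] [IsTopologicalRing R] {n : ℕ} (σ : R →+* R) (H H' : Matrix (Fin n) (Fin n) R)
  (D : GL (Fin n) R) {a : R}

/-- **`Ad(D)` IS A TOPOLOGICAL ISOMORPHISM `U(σ, H′) ≃ₜ* U(σ, H)`** when `ᵗ(σD) H D = a·H′` with `a ∈ Rˣ`: `D g D⁻¹ ∈ U(H) ⟺ g ∈ U(ᵗ(σD)HD) = U(a·H′) = U(H′)`.  Delivered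
existentially with its coe laws (`↑(e g) = D g D⁻¹`, `↑(e.symm g) = D⁻¹ g D`). [cite: Kottwitz1988, §2] [cite: Rogawski1990, §12.6 p. 174] -/
theorem exists_continuousMulEquiv_coe_eq_conj₂ (ha : IsUnit a) (hD : formCongr σ D H = a • H') :
    ∃ e : ↥(unitaryGroupOfForm σ H') ≃ₜ* ↥(unitaryGroupOfForm σ H),
      (∀ g, ((e g : ↥(unitaryGroupOfForm σ H)) : GL (Fin n) R) = D * g * D⁻¹) ∧
      ∀ g, ((e.symm g : ↥(unitaryGroupOfForm σ H')) : GL (Fin n) R) = D⁻¹ * g * D := by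
  have hmem : ∀ g : GL (Fin n) R, g ∈ unitaryGroupOfForm σ H' ↔ GLn.conjEquiv D g ∈ unitaryGroupOfForm σ H := by
    intro g
    rw [GLn.conjEquiv_apply, conj_mem_unitaryGroupOfForm_iff, hD, unitaryGroupOfForm_smul_of_isUnit σ ha]
  refine ⟨ContinuousMulEquiv.restrictSubgroup (GLn.conjEquiv D) _ _ hmem, fun g => ?_, fun g => ?_⟩
  · rw [ContinuousMulEquiv.coe_restrictSubgroup_apply, GLn.conjEquiv_apply]
  · rw [ContinuousMulEquiv.coe_restrictSubgroup_symm_apply]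
    have h : GLn.conjEquiv D (D⁻¹ * (g : GL (Fin n) R) * D) = g := by rw [GLn.conjEquiv_apply]; group
    conv_lhs => rw [← h, ContinuousMulEquiv.symm_apply_apply]

/-! ## §2 Levels and test functions across `e` -/

variable {σ H H' D}
variable (e : ↥(unitaryGroupOfForm σ H') ≃ₜ* ↥(unitaryGroupOfForm σ H)) (hes : ∀ g, ((e.symm g : ↥(unitaryGroupOfForm σ H')) : GL (Fin n) R) = D⁻¹ * g * D)

omit [IsTopologicalRing R] in
include hes in
/-- **`g ∈ DSD⁻¹ ∩ U(H) ↔ e.symm g ∈ S ∩ U(H′)`**: `↑g ∈ DSD⁻¹ ⟺ D⁻¹ ↑g D ∈ S`. [cite: Kottwitz1988, §2] -/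
theorem mem_subgroupOf_map_conj_iff₂ (S : Subgroup (GL (Fin n) R)) (g : ↥(unitaryGroupOfForm σ H)) :
    g ∈ (S.map (MulAut.conj D).toMonoidHom).subgroupOf (unitaryGroupOfForm σ H) ↔ e.symm g ∈ S.subgroupOf (unitaryGroupOfForm σ H') := by
  rw [Subgroup.mem_subgroupOf, Subgroup.mem_subgroupOf, hes, Subgroup.mem_map_equiv, MulAut.conj_symm_apply]

omit [IsTopologicalRing R] in
/-- **Conjugation invariance transports**: `φ : U(H) → E` invariant under `K`-conjugation ⇒ `φ ∘ e` invariant under `K′`-conjugation, for any pair `g ∈ K ↔ e.symm g ∈ K′`.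
[cite: Kottwitz1986, §3] -/
theorem conj_invariant_comp₂ {E : Type*} {K : Subgroup ↥(unitaryGroupOfForm σ H)} {K' : Subgroup ↥(unitaryGroupOfForm σ H')} (hK : ∀ g, g ∈ K ↔ e.symm g ∈ K')
    (φ : ↥(unitaryGroupOfForm σ H) → E) (hφ : ∀ k ∈ K, ∀ x, φ (k * x * k⁻¹) = φ x) :
    ∀ k ∈ K', ∀ x, (φ ∘ e) (k * x * k⁻¹) = (φ ∘ e) x := by
  intro k hk x
  simp only [Function.comp_apply, map_mul, map_inv]
  exact hφ _ ((hK _).2 (by simpa using hk)) _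

omit [IsTopologicalRing R] in
/-- **Right invariance transports**: `φ` right-invariant under `M ⊆ U(H)` ⇒ `φ ∘ e` right-invariant under `M′ ⊆ U(H′)`, for any pair `g ∈ M ↔ e.symm g ∈ M′`. [cite: Kottwitz1986, §3] -/
theorem mul_invariant_comp₂ {E : Type*} {M : Set ↥(unitaryGroupOfForm σ H)} {M' : Set ↥(unitaryGroupOfForm σ H')} (hM : ∀ g, g ∈ M ↔ e.symm g ∈ M')
    (φ : ↥(unitaryGroupOfForm σ H) → E) (hφ : ∀ x, ∀ y ∈ M, φ (x * y) = φ x) :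
    ∀ x, ∀ y ∈ M', (φ ∘ e) (x * y) = (φ ∘ e) x := by
  intro x y hy
  simp only [Function.comp_apply, map_mul]
  exact hφ _ _ ((hM _).2 (by simpa using hy))

omit [IsTopologicalRing R] in
/-- **Support transports**: `φ` vanishes off `K ⊆ U(H)` ⇒ `φ ∘ e` vanishes off `K′ ⊆ U(H′)` (any pair `g ∈ K ↔ e.symm g ∈ K′`). [cite: Kottwitz1988, §2] -/
theorem comp_eq_zero_of₂ {E : Type*} [Zero E] {K : Set ↥(unitaryGroupOfForm σ H)} {K' : Set ↥(unitaryGroupOfForm σ H')} (hK : ∀ g, g ∈ K ↔ e.symm g ∈ K')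
    (φ : ↥(unitaryGroupOfForm σ H) → E) (hφ : ∀ g ∉ K, φ g = 0) : ∀ g ∉ K', (φ ∘ e) g = 0 := by
  intro g hg
  exact hφ _ fun h => hg (by simpa using (hK _).1 h)

/-! ## §3 Fixed-point sums, counts, finiteness, frames across `e` -/

omit [IsTopologicalRing R] in
include hes in
/-- **FIXED-POINT SUMS ACROSS THE TWO-FORM TRANSPORT** (★ A-p16 `finsum_mem_fixedBy_quotient_congr_eq` along `e.symm` with `f′ := φ ∘ e`): for `φ : U(H) → E` invariant under
`(DSD⁻¹ ∩ U(H))`-conjugation, `Σᶠ_{q ∈ Fix_γ(U(H)⧸DSD⁻¹∩U(H))} φ(q.out⁻¹ γ q.out) = Σᶠ_{p ∈ Fix_{e⁻¹γ}(U(H′)⧸S∩U(H′))} φ(e(p.out⁻¹ (e⁻¹γ) p.out))` — the ramified VERTEX piece on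
`U(Φ₂)` is the edge-type sum on `U(J♯)`. [cite: Kottwitz1988, §2] [cite: Rogawski1990, §12.6 p. 174] [cite: Kottwitz1986, §3] -/
theorem finsum_fixedBy_quotient_mapConj_eq₂ {E : Type*} [AddCommMonoid E] (S : Subgroup (GL (Fin n) R)) (γ : ↥(unitaryGroupOfForm σ H))
    (φ : ↥(unitaryGroupOfForm σ H) → E) (hφ : ∀ k ∈ (S.map (MulAut.conj D).toMonoidHom).subgroupOf (unitaryGroupOfForm σ H), ∀ x, φ (k * x * k⁻¹) = φ x) :
    ∑ᶠ q ∈ fixedBy (↥(unitaryGroupOfForm σ H) ⧸ (S.map (MulAut.conj D).toMonoidHom).subgroupOf (unitaryGroupOfForm σ H)) γ, φ (q.out⁻¹ * γ * q.out) =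
      ∑ᶠ p ∈ fixedBy (↥(unitaryGroupOfForm σ H') ⧸ S.subgroupOf (unitaryGroupOfForm σ H')) (e.symm γ), φ (e (p.out⁻¹ * e.symm γ * p.out)) := by
  have hK := fun g => mem_subgroupOf_map_conj_iff₂ e hes S g
  have hcoe : ∀ x, e.symm.toMulEquiv x = e.symm x := fun _ => rfl
  have h := Literature.GroupTheory.finsum_mem_fixedBy_quotient_congr_eq ((S.map (MulAut.conj D).toMonoidHom).subgroupOf (unitaryGroupOfForm σ H))
    (S.subgroupOf (unitaryGroupOfForm σ H')) e.symm.toMulEquiv hK (φ ∘ e) (conj_invariant_comp₂ e hK φ hφ) γ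
  simp only [Function.comp_apply, hcoe, ContinuousMulEquiv.apply_symm_apply] at h
  exact h

omit [IsTopologicalRing R] in
include hes in
/-- **`#Fix_γ(U(H)⧸DSD⁻¹∩U(H)) = #Fix_{e⁻¹γ}(U(H′)⧸S∩U(H′))`** (as `Set.ncard`). [cite: Kottwitz1988, §2] [cite: Rogawski1990, §12.6 p. 174] -/
theorem ncard_fixedBy_quotient_mapConj_eq₂ (S : Subgroup (GL (Fin n) R)) (γ : ↥(unitaryGroupOfForm σ H)) :
    (fixedBy (↥(unitaryGroupOfForm σ H) ⧸ (S.map (MulAut.conj D).toMonoidHom).subgroupOf (unitaryGroupOfForm σ H)) γ).ncard =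
      (fixedBy (↥(unitaryGroupOfForm σ H') ⧸ S.subgroupOf (unitaryGroupOfForm σ H')) (e.symm γ)).ncard := by
  have hK := fun g => mem_subgroupOf_map_conj_iff₂ e hes S g
  have hcoe : ∀ x, e.symm.toMulEquiv x = e.symm x := fun _ => rfl
  obtain ⟨Ψ, -, hΨ⟩ := Literature.GroupTheory.exists_equiv_quotient_congr ((S.map (MulAut.conj D).toMonoidHom).subgroupOf (unitaryGroupOfForm σ H))
    (S.subgroupOf (unitaryGroupOfForm σ H')) e.symm.toMulEquiv hK
  rw [← hcoe, ← Literature.GroupTheory.image_fixedBy_quotient_congr_eq _ _ e.symm.toMulEquiv Ψ hΨ γ, Set.ncard_image_of_injective _ Ψ.injective]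

omit [IsTopologicalRing R] in
include hes in
/-- **Finiteness transports** across the two-form transport. [cite: Kottwitz1988, §2] -/
theorem finite_fixedBy_quotient_mapConj_iff₂ (S : Subgroup (GL (Fin n) R)) (γ : ↥(unitaryGroupOfForm σ H)) :
    (fixedBy (↥(unitaryGroupOfForm σ H) ⧸ (S.map (MulAut.conj D).toMonoidHom).subgroupOf (unitaryGroupOfForm σ H)) γ).Finite ↔
      (fixedBy (↥(unitaryGroupOfForm σ H') ⧸ S.subgroupOf (unitaryGroupOfForm σ H')) (e.symm γ)).Finite := by
  have hK := fun g => mem_subgroupOf_map_conj_iff₂ e hes S g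
  have hcoe : ∀ x, e.symm.toMulEquiv x = e.symm x := fun _ => rfl
  obtain ⟨Ψ, -, hΨ⟩ := Literature.GroupTheory.exists_equiv_quotient_congr ((S.map (MulAut.conj D).toMonoidHom).subgroupOf (unitaryGroupOfForm σ H))
    (S.subgroupOf (unitaryGroupOfForm σ H')) e.symm.toMulEquiv hK
  rw [← hcoe, ← Literature.GroupTheory.image_fixedBy_quotient_congr_eq _ _ e.symm.toMulEquiv Ψ hΨ γ, Set.finite_image_iff Ψ.injective.injOn]

omit [TopologicalSpace R] [IsTopologicalRing R] in
/-- **THE FRAME GRAM IS UNCHANGED IN THE TRANSPORTED FORM**: `twistGram σ (ᵗ(σD)HD) (D⁻¹P) = twistGram σ H P` (`D·D⁻¹P = P`). [cite: Rogawski1990, §3.1 p. 19; §12.6 p. 174] -/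
theorem twistGram_formCongr_coe_inv_mul (P : Matrix (Fin n) (Fin n) R) :
    twistGram σ (formCongr σ D H) (((D⁻¹ : GL (Fin n) R) : Matrix (Fin n) (Fin n) R) * P) = twistGram σ H P := by
  have hDD : ((D : GL (Fin n) R) : Matrix (Fin n) (Fin n) R) * ((D⁻¹ : GL (Fin n) R) : Matrix (Fin n) (Fin n) R) = 1 := by
    rw [← Units.val_mul, mul_inv_cancel, Units.val_one]
  have key : twistGram σ (formCongr σ D H) (((D⁻¹ : GL (Fin n) R) : Matrix (Fin n) (Fin n) R) * P) =
      twistGram σ H (((D : GL (Fin n) R) : Matrix (Fin n) (Fin n) R) * ((((D⁻¹ : GL (Fin n) R) : Matrix (Fin n) (Fin n) R)) * P)) := by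
    simp only [twistGram_def, formCongr, Matrix.map_mul, Matrix.transpose_mul, Matrix.mul_assoc]
  rw [key, ← Matrix.mul_assoc, hDD, Matrix.one_mul]

omit [TopologicalSpace R] [IsTopologicalRing R] in
/-- **THE `H′`-GRAM OF THE TRANSPORTED FRAME PICKS UP THE MULTIPLIER**: `twistGram σ H′ (D⁻¹P) = a⁻¹ • twistGram σ H P` when `ᵗ(σD)HD = a·H′` (★ FILE 1's `twistGram_coe_inv_mul_eq_inv_smul`
is the case `H′ = H`). [cite: Rogawski1990, §3.1 p. 19; §12.6 p. 174] -/
theorem twistGram_coe_inv_mul_eq_inv_smul₂ (ha : IsUnit a) (hD : formCongr σ D H = a • H') (P : Matrix (Fin n) (Fin n) R) :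
    twistGram σ H' (((D⁻¹ : GL (Fin n) R) : Matrix (Fin n) (Fin n) R) * P) = ((ha.unit⁻¹ : Rˣ) : R) • twistGram σ H P := by
  have hH' : H' = ((ha.unit⁻¹ : Rˣ) : R) • formCongr σ D H := by
    rw [hD, smul_smul, Units.inv_mul_of_eq (IsUnit.unit_spec ha), one_smul]
  rw [hH', twistGram_def, twistGram_def, Matrix.mul_smul, Matrix.smul_mul, ← twistGram_def, ← twistGram_def, twistGram_formCongr_coe_inv_mul]

omit [TopologicalSpace R] [IsTopologicalRing R] in
/-- Entrywise form: `twistGram σ H′ (D⁻¹P) i j = a⁻¹ · twistGram σ H P i j`. [cite: Rogawski1990, §3.1 p. 19] -/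
theorem twistGram_coe_inv_mul_apply₂ (ha : IsUnit a) (hD : formCongr σ D H = a • H') (P : Matrix (Fin n) (Fin n) R) (i j : Fin n) :
    twistGram σ H' (((D⁻¹ : GL (Fin n) R) : Matrix (Fin n) (Fin n) R) * P) i j = ((ha.unit⁻¹ : Rˣ) : R) * twistGram σ H P i j := by
  rw [twistGram_coe_inv_mul_eq_inv_smul₂ ha hD P, Matrix.smul_apply, smul_eq_mul]

end Generic

/-! ## §4 The CM one-place model at a RAMIFIED place: `D_ϖ = diag(1, ϖ_E)`, `ᵗ(σD_ϖ)(Φ₂)_w D_ϖ = ϖ_E • J♯`, `e_ϖ : U(σ_w, J♯) ≃ₜ* U(σ_w, (Φ₂)_w)` -/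

section CM

variable (L : Type) [Field L] [NumberField L] [IsCMField L] {v : HeightOneSpectrum (𝓞 ↥(maximalRealSubfield L))}
  (w : UnitaryGroup.PlacesOver L v) (hw : IsCMField.complexConj L • w.1 = w.1)

/-- **`ᵗ(σ_w D_ϖ) (Φ₂)_w D_ϖ = ϖ_E • J♯`**, `J♯ = [[0,1],[−1,0]]`, for a SKEW unit `ϖ_E` (`σ_w ϖ_E = −ϖ_E`; the uniformizer of `L_w` at a tamely ramified place, ★ p843426): at a ramified
place `D_ϖ = diag(1, ϖ_E)` is NOT a similitude of `Φ₂` — it carries the hermitian form to a (multiple of a) SKEW-hermitian one. [cite: Rogawski1990, §12.6 p. 174]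
[cite: LabesseLanglands1979, §2] -/
theorem formCongr_glDiagonal_skew_eq_smul_skewForm (ϖ : (w.1.adicCompletion L)ˣ)
    (hσϖ : galAdicCompletionMap (L := L) (IsCMField.complexConj L) hw (ϖ : w.1.adicCompletion L) = -ϖ) :
    formCongr (galAdicCompletionMap (L := L) (IsCMField.complexConj L) hw) (glDiagonal 2 (w.1.adicCompletion L) ![1, ϖ])
        (UnitaryGroup.placeForm (Matrix.of fun i j : Fin 2 => if i.val + j.val + 1 = 2 then (1 : L) else 0) w.1) =
      (ϖ : w.1.adicCompletion L) • !![(0 : w.1.adicCompletion L), 1; -1, 0] := by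
  have hΦ : UnitaryGroup.placeForm (Matrix.of fun i j : Fin 2 => if i.val + j.val + 1 = 2 then (1 : L) else 0) w.1 =
      Matrix.of fun i j : Fin 2 => if i.val + j.val + 1 = 2 then (1 : w.1.adicCompletion L) else 0 := by
    ext i j
    simp only [UnitaryGroup.placeForm, Matrix.map_apply, Matrix.of_apply]
    split_ifs <;> simp
  rw [hΦ, formCongr, coe_glDiagonal, Matrix.diagonal_map (map_zero _), Matrix.diagonal_transpose]
  ext i j
  rw [Matrix.mul_diagonal, Matrix.diagonal_mul, Matrix.smul_apply, Matrix.of_apply, smul_eq_mul]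
  fin_cases i <;> fin_cases j <;> simp [hσϖ]

/-- **`e_ϖ = Ad(D_ϖ) : U(σ_w, J♯) ≃ₜ* U(σ_w, (Φ₂)_w)` AT A RAMIFIED PLACE**, `D_ϖ = glDiagonal 2 L_w ![1, ϖ_E]`, with, for EVERY level `S ≤ GL₂(L_w)`,
`g ∈ (D_ϖ S D_ϖ⁻¹) ∩ U(Φ₂) ↔ e_ϖ.symm g ∈ S ∩ U(J♯)` — with `S = GL₂(𝒪_w)`: the ramified VERTEX stabiliser `K♯ ≤ U(Φ₂)` is the integral points of `U(J♯)`; the vertex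
piece of (R5b-α) is §3's finsum identity + the `J♯`-side expansion (★ B-p12 `…RamifiedModular`). [cite: Kottwitz1988, §2] [cite: Rogawski1990, §12.6 p. 174] -/
theorem exists_continuousMulEquiv_sharp_of_skew (ϖ : (w.1.adicCompletion L)ˣ)
    (hσϖ : galAdicCompletionMap (L := L) (IsCMField.complexConj L) hw (ϖ : w.1.adicCompletion L) = -ϖ) :
    ∃ e : ↥(unitaryGroupOfForm (galAdicCompletionMap (L := L) (IsCMField.complexConj L) hw) !![(0 : w.1.adicCompletion L), 1; -1, 0]) ≃ₜ*
        ↥(unitaryGroupOfForm (galAdicCompletionMap (L := L) (IsCMField.complexConj L) hw)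
          (UnitaryGroup.placeForm (Matrix.of fun i j : Fin 2 => if i.val + j.val + 1 = 2 then (1 : L) else 0) w.1)),
      (∀ g, ((e g : ↥(unitaryGroupOfForm (galAdicCompletionMap (L := L) (IsCMField.complexConj L) hw)
          (UnitaryGroup.placeForm (Matrix.of fun i j : Fin 2 => if i.val + j.val + 1 = 2 then (1 : L) else 0) w.1))) : GL (Fin 2) (w.1.adicCompletion L)) =
        glDiagonal 2 (w.1.adicCompletion L) ![1, ϖ] * g * (glDiagonal 2 (w.1.adicCompletion L) ![1, ϖ])⁻¹) ∧
      (∀ g, ((e.symm g : ↥(unitaryGroupOfForm (galAdicCompletionMap (L := L) (IsCMField.complexConj L) hw) !![(0 : w.1.adicCompletion L), 1; -1, 0])) :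
          GL (Fin 2) (w.1.adicCompletion L)) = (glDiagonal 2 (w.1.adicCompletion L) ![1, ϖ])⁻¹ * g * glDiagonal 2 (w.1.adicCompletion L) ![1, ϖ]) ∧
      ∀ (S : Subgroup (GL (Fin 2) (w.1.adicCompletion L))) g,
        g ∈ (S.map (MulAut.conj (glDiagonal 2 (w.1.adicCompletion L) ![1, ϖ])).toMonoidHom).subgroupOf _ ↔ e.symm g ∈ S.subgroupOf _ := by
  obtain ⟨e, he, hes⟩ := exists_continuousMulEquiv_coe_eq_conj₂ (galAdicCompletionMap (L := L) (IsCMField.complexConj L) hw)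
    (UnitaryGroup.placeForm (Matrix.of fun i j : Fin 2 => if i.val + j.val + 1 = 2 then (1 : L) else 0) w.1) !![(0 : w.1.adicCompletion L), 1; -1, 0]
    (glDiagonal 2 (w.1.adicCompletion L) ![1, ϖ]) ϖ.isUnit (formCongr_glDiagonal_skew_eq_smul_skewForm L w hw ϖ hσϖ)
  exact ⟨e, he, hes, fun S g => mem_subgroupOf_map_conj_iff₂ e hes S g⟩

include hw in
/-- At a tamely RAMIFIED non-split place (`e(w|v) ≠ 1`, `|2|_w = 1`) a skew UNIFORMIZER `ϖ_E` exists (★ p843426), so `exists_continuousMulEquiv_sharp_of_skew` applies with `D_ϖ = diag(1, ϖ_E)`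
integral of determinant-valuation one — the barycentric picture: `D_ϖ` moves the self-dual MIDPOINT lattice to a `ϖ_E`-modular VERTEX lattice. [cite: Rogawski1990, §12.6 p. 174]
[cite: LabesseLanglands1979, §2] -/
theorem exists_skew_uniformizer_formCongr_eq_smul_skewForm (he : v.asIdeal.ramificationIdx' w.1.asIdeal ≠ 1) (h2 : Valued.v (2 : w.1.adicCompletion L) = 1) :
    ∃ ϖ : (w.1.adicCompletion L)ˣ, Valued.v (ϖ : w.1.adicCompletion L) = WithZero.exp (-1 : ℤ) ∧
      galAdicCompletionMap (L := L) (IsCMField.complexConj L) hw (ϖ : w.1.adicCompletion L) = -ϖ ∧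
      formCongr (galAdicCompletionMap (L := L) (IsCMField.complexConj L) hw) (glDiagonal 2 (w.1.adicCompletion L) ![1, ϖ])
          (UnitaryGroup.placeForm (Matrix.of fun i j : Fin 2 => if i.val + j.val + 1 = 2 then (1 : L) else 0) w.1) =
        (ϖ : w.1.adicCompletion L) • !![(0 : w.1.adicCompletion L), 1; -1, 0] := by
  obtain ⟨ϖ, hϖv, hσϖ⟩ := UnitaryGroup.exists_uniformizer_galAdicCompletionMap_complexConj_eq_neg_of_ramified L w hw he h2
  exact ⟨ϖ, hϖv, hσϖ, formCongr_glDiagonal_skew_eq_smul_skewForm L w hw ϖ hσϖ⟩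

end CM

end Literature.NumberTheory.Automorphic

end
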